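import Summits.BirchSwinnertonDyer.Statement
import Summits.BirchSwinnertonDyer.BirchSwinnertonDyer.Theorems.HigherGrossZagierDefs
import Literature.NumberTheory.EllipticCurves.Heights
import Literature.NumberTheory.EllipticCurves.GrossZagierRankOne

/-!
# BirchSwinnertonDyer / HigherGrossZagier — the rank-one datum

Problem `BirchSwinnertonDyer`, topic `HigherGrossZagier` (item stmt-BirchSwinnertonDyer-0524,
crux #6: the rank-one instance of the posited interface `Literature.EllArith.HigherGrossZagierDatum`).

Assuming the two Literature named facts
* `WeierstrassCurve.gross_zagier_rank_one_rat` (rank-one Gross–Zagier over `ℚ`: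
  `r_an(E) = 1 ⇒ ∃ P ∈ E(ℚ), c > 0, L'(E,1) = c · ĥ(P)`; Gross–Zagier 1986, Thm. I.6.3 and §V.2,
  with a non-vanishing quadratic twist, Bump–Friedberg–Hoffstein 1990 / Murty–Murty 1991), and
* `WeierstrassCurve.Affine.Point.heightPairing_self` (`⟨P,P⟩ = ĥ(P)`; Silverman AEC VIII.9.3),
every `E/ℚ` with `r_an(E) = 1` carries a `HigherGrossZagierDatum W W.analyticRank`: `P := ![P]`,
the `1 × 1` Gram determinant being `⟨P,P⟩ = ĥ(P)`.

Sources: B. Gross, D. Zagier, Invent. Math. 84 (1986), Thm. I.6.3, §V.2; J. Silverman,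
*The Arithmetic of Elliptic Curves*, Thm. VIII.9.3.
-/

namespace Literature.EllArith

open WeierstrassCurve WeierstrassCurve.Affine.Point

/-- Settles stmt-BirchSwinnertonDyer-0524: under rank-one Gross–Zagier over `ℚ` and
`⟨P,P⟩ = ĥ(P)`, an elliptic curve `E/ℚ` of analytic rank `1` has a rank-`r_an` Gross–Zagier
datum (`P := ![P]`, `det` of the `1 × 1` Gram matrix `= ĥ(P)`).
[Gross–Zagier 1986, Thm. I.6.3 and §V.2] [folklore] -/
theorem nonempty_higherGrossZagierDatum_of_analyticRank_eq_one
    (h1 : WeierstrassCurve.gross_zagier_rank_one_rat)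
    (h2 : ∀ (V : WeierstrassCurve ℚ), @WeierstrassCurve.Affine.Point.heightPairing_self ℚ _ _ V)
    (W : WeierstrassCurve ℚ) [W.IsElliptic] (hr : W.analyticRank = 1) :
    Nonempty (Literature.EllArith.HigherGrossZagierDatum W W.analyticRank) := by
  obtain ⟨P, c, hc, hL⟩ := h1 W hr
  rw [hr]
  refine ⟨⟨![P], c, hc, ?_⟩⟩
  have hL2 : iteratedDeriv 1 W.entireLFunction 1 / ((1 : ℕ).factorial : ℂ) =
      ((c * P.canonicalHeight : ℝ) : ℂ) := by
    have := hL
    simp only [WeierstrassCurve.leadingLCoeff, hr] at this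
    simpa using this
  rw [hL2]
  congr 1
  rw [Matrix.det_fin_one]
  simp [h2 W P]

end Literature.EllArith
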